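import Mathlib.LinearAlgebra.TensorProduct.Pi
import Mathlib.LinearAlgebra.TensorProduct.RightExactness
import Literature.NumberTheory.GaloisRepresentations.HasseNormEtaleInvolution
import HarnessLib

/-!
# The factors of a finite étale algebra with involution, adelically: projections to the residue number fields, the product
# decomposition of `𝔸_F ⊗_F B`, and the GLOBAL EXISTENCE half of the obstruction exactness (Rogawski 1990 §3.5 Prop. 3.5.2;
# Cassels–Fröhlich II §14, VII §7)

Topic `NumberTheory/GaloisRepresentations`; namespace `Literature.NumberTheory.GaloisRepresentations`.  THEOREMS ONLY (no definition, no
instance, no notation, no named fact; D-0026, net debt 0); universe `Type`.  Sequel of ★ `HasseNormEtaleInvolution` (same letters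
`(B, τ)`: a finite reduced commutative `F`-algebra with an `F`-involution), supplying the DICTIONARY its head did without: the row G6∕R6
(`Rogawski1990/CartanObstruction`: the obstruction `cartanObs : 𝒞_𝐀(γ₀) → 𝔈(T∕F) = {ε ∈ (ℤ∕2)^{r′} : Σ ε = 0}` of a regular stable class
of a unitary group, [Rogawski1990, §3.5 Prop. 3.5.2 (c), §5.4]) reads an adelic Cartan class `X ∈ (𝔸_F ⊗_F B)^τ`, `B = L[γ₀]`,
FACTOR BY FACTOR at the `τ`-stable maximal ideals `𝔪` of `B` (residue number fields `C = B∕𝔪` with the induced involution `τ_C ≠ 1`),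
through the quadratic norm-residue indicator of `C ∕ C^{τ_C}` (★ `QuadraticIdeleNormResidueExact`).  DEF-FREE interface: a factor is
presented abstractly as `π : B →ₐ[F] C`, `τ_C : C ≃ₐ[F] C` with `π ∘ τ = τ_C ∘ π` (the consumer instantiates `C := B ⧸ 𝔪`).

THE PRINT.  [Rogawski1990, §3.5 p. 29–30]: `H¹(F, T) ≅ ⊕_j K_jˣ ∕ N(K′_jˣ)` over the field factors of the Cartan algebra, `𝔈(T∕F)` its
adelic-modulo-global quotient; [CasselsFrohlichANT1967, Ch. II §14]: `V_L = V_K ⊗_K L` and `V ⊗ (A × B) = (V ⊗ A) × (V ⊗ B)`; Ch. VII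
§7.1∕§7.3 (a): the Galois action on `𝔸_L = 𝔸_K ⊗ L` is `1 ⊗ σ`, `𝔸_L^{G} = 𝔸_K`.

WHAT IS PROVED.
* §1 (D1) for a factor `(C, π, τ_C)`: `(1 ⊗ π)(1 ⊗ τ) = (1 ⊗ τ_C)(1 ⊗ π)` (`map_map_eq_map_map_of_comm`); **`smul_adeleRingTensorAlgEquiv_map`**:
  `τ_C • e_C((1 ⊗ π) y) = e_C((1 ⊗ π)(1 ⊗ τ) y)` (★ `smul_adeleRingTensorAlgEquiv`), so a `τ`-fixed `y` projects to a `τ_C`-FIXED adele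
  (`…_eq_self`; then ★ `AdeleRing.mem_range_baseChange_iff` descends it to the fixed field); the NORM READING
  **`adeleRingTensorAlgEquiv_map_tmul_mul_mul_map`**: `e_C((1 ⊗ π)((1 ⊗ b) t (1 ⊗ τ)t)) = (π b) · (Z · τ_C • Z)` — principal times idelic norm.
* §2 (D2) **`exists_unique_forall_map_mk_eq`**: the projections `(1 ⊗ π_𝔪) : 𝔸_F ⊗_F B → 𝔸_F ⊗_F B∕𝔪` are JOINTLY BIJECTIVE
  (`B ≅ ∏ B∕𝔪`, Mathlib `IsArtinianRing.equivPi`; `⊗` commutes with finite products, Mathlib `TensorProduct.piRight`), `eq_of_forall_map_mk_eq`;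
  the TWISTED PROJECTION `(1 ⊗ π_I)(1 ⊗ τ) = (1 ⊗ τ̄)(1 ⊗ π_{τ⁻¹I})` (`map_mk_map_eq`, `map_mk_map_eq_of_map_mk_comap_eq`).
* §3 (D3) **`exists_fixed_unit_tmul_mul_mul_map_eq`** (GLOBAL EXISTENCE): a `τ`-fixed unit `X` of `𝔸_F ⊗_F B` whose projection at every
  `τ`-STABLE `𝔪` is «principal `τ`-fixed × norm» modulo `𝔪` is globally of that shape: `X = (1 ⊗ y) · t · (1 ⊗ τ)t`, `y ∈ Bˣ` `τ`-fixed,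
  `t` a unit — the pairs `{𝔪, τ𝔪}` need nothing (`(y, t) = (1, (X, 1))` there, by `(1 ⊗ τ)X = X`); `exists_map_mk_eq_of_unit` lifts the local
  units (`⊗` right exact, Mathlib `LinearMap.lTensor_surjective`).  With (D1) this is the exactness «`obs(X) = 0 ⇔ X` is a global class times a
  norm» of [Rogawski1990, Prop. 3.5.2 (c)] at the `τ`-stable factors, the per-factor input being ★ `QuadraticIdeleNormResidueExact`.
* §4 (D4, ed. 2) **`exists_repr_of_adeleRingTensorAlgEquiv_map_eq`**: from the factor's adelic equation `e_C((1 ⊗ π)X) = (k_C) · (U · τ_C • U)`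
  to the representative data `(k, u, u′)` that (D3) consumes (`π` onto, `⊗` right exact).

## References
* J. D. Rogawski, *Automorphic Representations of Unitary Groups in Three Variables*, Ann. of Math. Stud. 123 (1990), §3.5 Prop. 3.5.2,
  §5.4 p. 72 [Rogawski1990].
* J. W. S. Cassels, A. Fröhlich (eds.), *Algebraic Number Theory* (1967), Ch. II §14, §19; Ch. VII §7.1, §7.3, §9.6 [CasselsFrohlichANT1967].
-/

noncomputable section

open NumberField IsDedekindDomain
open scoped TensorProduct

namespace Literature.NumberTheory.GaloisRepresentations

/-! ## §1 (D1) A `τ`-stable factor, abstractly: `π : B → C` onto a number field with `π ∘ τ = τ_C ∘ π` -/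

section Factor

open scoped NumberField.AdeleRing
open Literature.NumberTheory.AdelicBaseChange Literature.NumberTheory.Automorphic

variable {F B C : Type} [Field F] [NumberField F] [CommRing B] [Algebra F B] [Field C] [NumberField C] [Algebra F C]
  (τ : B ≃ₐ[F] B) (π : B →ₐ[F] C) (τC : C ≃ₐ[F] C) (hτπ : ∀ b, π (τ b) = τC (π b))
include hτπ

omit [NumberField C] in
/-- `(1 ⊗ π) ∘ (1 ⊗ τ) = (1 ⊗ τ_C) ∘ (1 ⊗ π)` on `𝔸_F ⊗_F B`. [cite: CasselsFrohlichANT1967, Ch. VII §7.1] -/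
theorem map_map_eq_map_map_of_comm (y : AdeleRing (𝓞 F) F ⊗[F] B) :
    Algebra.TensorProduct.map (AlgHom.id (AdeleRing (𝓞 F) F) (AdeleRing (𝓞 F) F)) π
        (Algebra.TensorProduct.map (AlgHom.id (AdeleRing (𝓞 F) F) (AdeleRing (𝓞 F) F)) (τ : B →ₐ[F] B) y) =
      Algebra.TensorProduct.map (AlgHom.id (AdeleRing (𝓞 F) F) (AdeleRing (𝓞 F) F)) (τC : C →ₐ[F] C)
        (Algebra.TensorProduct.map (AlgHom.id (AdeleRing (𝓞 F) F) (AdeleRing (𝓞 F) F)) π y) := by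
  rw [← AlgHom.comp_apply, ← AlgHom.comp_apply, ← Algebra.TensorProduct.map_id_comp, ← Algebra.TensorProduct.map_id_comp]
  congr 2
  ext b
  exact hτπ b

/-- **(D1) the projection to a `τ`-stable factor intertwines `1 ⊗ τ` with the GALOIS ACTION of `τ_C` on `𝔸_C`**:
`τ_C • e_C((1 ⊗ π) y) = e_C((1 ⊗ π)((1 ⊗ τ) y))` (`e_C : 𝔸_F ⊗_F C ≅ 𝔸_C`, Cassels–Fröhlich (19.1); Tate VII §7.1).
[cite: CasselsFrohlichANT1967, Ch. VII §7.1] -/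
theorem smul_adeleRingTensorAlgEquiv_map (y : AdeleRing (𝓞 F) F ⊗[F] B) :
    τC • adeleRingTensorAlgEquiv F C (Algebra.TensorProduct.map (AlgHom.id (AdeleRing (𝓞 F) F) (AdeleRing (𝓞 F) F)) π y) =
      adeleRingTensorAlgEquiv F C (Algebra.TensorProduct.map (AlgHom.id (AdeleRing (𝓞 F) F) (AdeleRing (𝓞 F) F)) π
        (Algebra.TensorProduct.map (AlgHom.id (AdeleRing (𝓞 F) F) (AdeleRing (𝓞 F) F)) (τ : B →ₐ[F] B) y)) := by
  rw [smul_adeleRingTensorAlgEquiv, map_map_eq_map_map_of_comm τ π τC hτπ]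

/-- **A `τ`-fixed element of `𝔸_F ⊗_F B` projects to a `τ_C`-FIXED adele of `C`** (hence, by Galois descent for the quadratic
`C ∕ C^{τ_C}` — ★ `AdeleRing.mem_range_baseChange_iff` — to an adele of the fixed field). [cite: CasselsFrohlichANT1967, Ch. VII §7.3 (a)] -/
theorem smul_adeleRingTensorAlgEquiv_map_eq_self {y : AdeleRing (𝓞 F) F ⊗[F] B}
    (hy : Algebra.TensorProduct.map (AlgHom.id (AdeleRing (𝓞 F) F) (AdeleRing (𝓞 F) F)) (τ : B →ₐ[F] B) y = y) :
    τC • adeleRingTensorAlgEquiv F C (Algebra.TensorProduct.map (AlgHom.id (AdeleRing (𝓞 F) F) (AdeleRing (𝓞 F) F)) π y) =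
      adeleRingTensorAlgEquiv F C (Algebra.TensorProduct.map (AlgHom.id (AdeleRing (𝓞 F) F) (AdeleRing (𝓞 F) F)) π y) := by
  rw [smul_adeleRingTensorAlgEquiv_map τ π τC hτπ, hy]

/-- **The norm reading at a factor**: `e_C((1 ⊗ π)((1 ⊗ b) · t · (1 ⊗ τ) t)) = (π b)_{𝔸_C} · (Z · τ_C • Z)` with
`Z = e_C((1 ⊗ π) t)` — a principal adele times an idelic norm for `C ∕ C^{τ_C}` (so the quadratic norm-residue indicator of
`QuadraticIdeleNormResidueExact` kills it). [cite: CasselsFrohlichANT1967, Ch. VII §7.1] -/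
theorem adeleRingTensorAlgEquiv_map_tmul_mul_mul_map (b : B) (t : AdeleRing (𝓞 F) F ⊗[F] B) :
    adeleRingTensorAlgEquiv F C (Algebra.TensorProduct.map (AlgHom.id (AdeleRing (𝓞 F) F) (AdeleRing (𝓞 F) F)) π
        ((1 : AdeleRing (𝓞 F) F) ⊗ₜ b * t *
          Algebra.TensorProduct.map (AlgHom.id (AdeleRing (𝓞 F) F) (AdeleRing (𝓞 F) F)) (τ : B →ₐ[F] B) t)) =
      algebraMap C (AdeleRing (𝓞 C) C) (π b) *
        (adeleRingTensorAlgEquiv F C (Algebra.TensorProduct.map (AlgHom.id (AdeleRing (𝓞 F) F) (AdeleRing (𝓞 F) F)) π t) *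
          τC • adeleRingTensorAlgEquiv F C
            (Algebra.TensorProduct.map (AlgHom.id (AdeleRing (𝓞 F) F) (AdeleRing (𝓞 F) F)) π t)) := by
  rw [map_mul, map_mul, map_mul, map_mul, Algebra.TensorProduct.map_tmul, AlgHom.id_apply, adeleRingTensorAlgEquiv_one_tmul,
    smul_adeleRingTensorAlgEquiv_map τ π τC hτπ, mul_assoc]

end Factor

/-! ## §2 (D2) The product decomposition `𝔸_F ⊗_F B ≅ ∏_𝔪 𝔸_F ⊗_F B∕𝔪` by the projections, and the twisted projections -/

section Product

variable {F B : Type} [Field F] [NumberField F] [CommRing B] [Algebra F B] (τ : B ≃ₐ[F] B)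

/-- **(D2) the projections `(1 ⊗ π_𝔪) : 𝔸_F ⊗_F B → 𝔸_F ⊗_F B∕𝔪` are JOINTLY BIJECTIVE** for a finite reduced `F`-algebra `B`
(`B ≅ ∏_𝔪 B∕𝔪`, Mathlib `IsArtinianRing.equivPi`, and `⊗` commutes with finite products, Mathlib `TensorProduct.piRight`):
injectivity and surjectivity stated separately, with no new object. [cite: CasselsFrohlichANT1967, Ch. II §14] -/
theorem exists_unique_forall_map_mk_eq [Module.Finite F B] [IsReduced B]
    (s : ∀ I : MaximalSpectrum B, AdeleRing (𝓞 F) F ⊗[F] (B ⧸ I.asIdeal)) :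
    ∃! z : AdeleRing (𝓞 F) F ⊗[F] B, ∀ I : MaximalSpectrum B,
      Algebra.TensorProduct.map (AlgHom.id (AdeleRing (𝓞 F) F) (AdeleRing (𝓞 F) F)) (Ideal.Quotient.mkₐ F I.asIdeal) z = s I := by
  classical
  haveI : IsArtinianRing B := IsArtinianRing.of_finite F B
  haveI : Fintype (MaximalSpectrum B) := Fintype.ofFinite _
  -- `Θ : 𝔸_F ⊗ B ≃ ∏_𝔪 𝔸_F ⊗ B/𝔪`, `(Θ z)_𝔪 = (1 ⊗ π_𝔪) z`
  let eB : B ≃ₗ[F] (∀ I : MaximalSpectrum B, B ⧸ I.asIdeal) :=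
    ((IsArtinianRing.equivPi B).restrictScalars F).toLinearEquiv
  let Θ : AdeleRing (𝓞 F) F ⊗[F] B ≃ₗ[F] ∀ I : MaximalSpectrum B, AdeleRing (𝓞 F) F ⊗[F] (B ⧸ I.asIdeal) :=
    (TensorProduct.congr (LinearEquiv.refl F (AdeleRing (𝓞 F) F)) eB).trans
      (TensorProduct.piRight F F (AdeleRing (𝓞 F) F) (fun I : MaximalSpectrum B => B ⧸ I.asIdeal))
  have hΘ : ∀ z I, Θ z I =
      Algebra.TensorProduct.map (AlgHom.id (AdeleRing (𝓞 F) F) (AdeleRing (𝓞 F) F)) (Ideal.Quotient.mkₐ F I.asIdeal) z := by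
    intro z I
    induction z using TensorProduct.induction_on with
    | zero => simp only [map_zero, Pi.zero_apply]
    | tmul r b =>
        simp only [Θ, LinearEquiv.trans_apply, TensorProduct.congr_tmul, LinearEquiv.refl_apply,
          Algebra.TensorProduct.map_tmul, AlgHom.id_apply, Ideal.Quotient.mkₐ_eq_mk]
        rfl
    | add x y hx hy => simp only [map_add, Pi.add_apply, hx, hy]
  refine ⟨Θ.symm s, fun I => by rw [← hΘ, LinearEquiv.apply_symm_apply], fun z hz => ?_⟩
  apply Θ.injective
  funext I
  rw [hΘ, hz I, LinearEquiv.apply_symm_apply]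

/-- **The twisted projection**: `(1 ⊗ π_I)((1 ⊗ τ) z) = (1 ⊗ τ̄)((1 ⊗ π_J) z)` for `J = τ⁻¹(I)` (`= comap τ I`) and the induced
`τ̄ : B∕J → B∕I`; in particular it depends on `z` only through `(1 ⊗ π_J) z`. [cite: CasselsFrohlichANT1967, Ch. VII §7.1] -/
theorem map_mk_map_eq (I : Ideal B) (z : AdeleRing (𝓞 F) F ⊗[F] B) :
    Algebra.TensorProduct.map (AlgHom.id (AdeleRing (𝓞 F) F) (AdeleRing (𝓞 F) F)) (Ideal.Quotient.mkₐ F I)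
        (Algebra.TensorProduct.map (AlgHom.id (AdeleRing (𝓞 F) F) (AdeleRing (𝓞 F) F)) (τ : B →ₐ[F] B) z) =
      Algebra.TensorProduct.map (AlgHom.id (AdeleRing (𝓞 F) F) (AdeleRing (𝓞 F) F))
          (Ideal.quotientMapₐ I (τ : B →ₐ[F] B) (le_refl (I.comap (τ : B →ₐ[F] B))))
        (Algebra.TensorProduct.map (AlgHom.id (AdeleRing (𝓞 F) F) (AdeleRing (𝓞 F) F)) (Ideal.Quotient.mkₐ F (I.comap (τ : B →ₐ[F] B))) z) := by
  rw [← AlgHom.comp_apply, ← AlgHom.comp_apply, ← Algebra.TensorProduct.map_id_comp, ← Algebra.TensorProduct.map_id_comp,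
    Ideal.quotient_map_comp_mkₐ]

/-- If two elements have the same `J`-projection, `J = τ⁻¹(I)`, their `τ`-images have the same `I`-projection.
[cite: CasselsFrohlichANT1967, Ch. VII §7.1] -/
theorem map_mk_map_eq_of_map_mk_comap_eq (I : Ideal B) {z z' : AdeleRing (𝓞 F) F ⊗[F] B}
    (h : Algebra.TensorProduct.map (AlgHom.id (AdeleRing (𝓞 F) F) (AdeleRing (𝓞 F) F)) (Ideal.Quotient.mkₐ F (I.comap (τ : B →ₐ[F] B))) z =
      Algebra.TensorProduct.map (AlgHom.id (AdeleRing (𝓞 F) F) (AdeleRing (𝓞 F) F)) (Ideal.Quotient.mkₐ F (I.comap (τ : B →ₐ[F] B))) z') :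
    Algebra.TensorProduct.map (AlgHom.id (AdeleRing (𝓞 F) F) (AdeleRing (𝓞 F) F)) (Ideal.Quotient.mkₐ F I)
        (Algebra.TensorProduct.map (AlgHom.id (AdeleRing (𝓞 F) F) (AdeleRing (𝓞 F) F)) (τ : B →ₐ[F] B) z) =
      Algebra.TensorProduct.map (AlgHom.id (AdeleRing (𝓞 F) F) (AdeleRing (𝓞 F) F)) (Ideal.Quotient.mkₐ F I)
        (Algebra.TensorProduct.map (AlgHom.id (AdeleRing (𝓞 F) F) (AdeleRing (𝓞 F) F)) (τ : B →ₐ[F] B) z') := by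
  rw [map_mk_map_eq, map_mk_map_eq, h]


/-- Injectivity half of (D2): an element of `𝔸_F ⊗_F B` is determined by its projections to the `𝔸_F ⊗_F B∕𝔪`.
[cite: CasselsFrohlichANT1967, Ch. II §14] -/
theorem eq_of_forall_map_mk_eq [Module.Finite F B] [IsReduced B] {z z' : AdeleRing (𝓞 F) F ⊗[F] B}
    (h : ∀ I : MaximalSpectrum B,
      Algebra.TensorProduct.map (AlgHom.id (AdeleRing (𝓞 F) F) (AdeleRing (𝓞 F) F)) (Ideal.Quotient.mkₐ F I.asIdeal) z =
        Algebra.TensorProduct.map (AlgHom.id (AdeleRing (𝓞 F) F) (AdeleRing (𝓞 F) F)) (Ideal.Quotient.mkₐ F I.asIdeal) z') :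
    z = z' :=
  (exists_unique_forall_map_mk_eq (F := F) (B := B) fun I =>
      Algebra.TensorProduct.map (AlgHom.id (AdeleRing (𝓞 F) F) (AdeleRing (𝓞 F) F)) (Ideal.Quotient.mkₐ F I.asIdeal) z').unique
    h (fun _ => rfl)

end Product

/-! ## §3 (D3) Global existence: per-factor norm data at the `τ`-stable factors glue to `X = (1 ⊗ y) · t · (1 ⊗ τ)t` -/

section Global

variable {F B : Type} [Field F] [NumberField F] [CommRing B] [Algebra F B] (τ : B ≃ₐ[F] B)

/-- **(D3) GLOBAL EXISTENCE** (the (←) half of the exactness `cartanObs = 0 ⇒ global class`).  Let `B` be a finite reduced `F`-algebra with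
an `F`-involution `τ`, and `X` a `τ`-fixed unit of `𝔸_F ⊗_F B`.  Suppose that at every `τ`-STABLE maximal ideal `𝔪` (`τ⁻¹𝔪 = 𝔪`) the
projection of `X` to `𝔸_F ⊗_F B∕𝔪` is «principal `τ`-fixed × norm»: `(1 ⊗ π_𝔪) X = (1 ⊗ π_𝔪)((1 ⊗ k) · u · (1 ⊗ τ)u)` for some `k ∈ B ∖ 𝔪`
with `τ k ≡ k (mod 𝔪)` and some `u ∈ 𝔸_F ⊗_F B` invertible modulo `𝔪` (this is what the vanishing of the quadratic norm-residue indicator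
of the factor gives, ★ `QuadraticIdeleNormResidueExact` + Galois descent).  THEN `X = (1 ⊗ y) · t · (1 ⊗ τ)t` for a `τ`-FIXED UNIT
`y ∈ B` and a unit `t` of `𝔸_F ⊗_F B` — the pairs `{𝔪, τ𝔪}` of non-stable maximal ideals impose no condition (there `(y, t) = (1, (X, 1))`,
using `(1 ⊗ τ)X = X`).  Glued through `B ≅ ∏ B∕𝔪` and `𝔸_F ⊗_F B ≅ ∏ 𝔸_F ⊗_F B∕𝔪` ((D2)).
[cite: Rogawski1990, §3.5 Prop. 3.5.2 (c)] [cite: CasselsFrohlichANT1967, Ch. VII §9.6] -/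
theorem exists_fixed_unit_tmul_mul_mul_map_eq [Module.Finite F B] [IsReduced B] (hτ : ∀ b, τ (τ b) = b)
    (X : (AdeleRing (𝓞 F) F ⊗[F] B)ˣ)
    (hX : Algebra.TensorProduct.map (AlgHom.id (AdeleRing (𝓞 F) F) (AdeleRing (𝓞 F) F)) (τ : B →ₐ[F] B) X = X)
    (hloc : ∀ I : MaximalSpectrum B, I.asIdeal.comap (τ : B →ₐ[F] B) = I.asIdeal →
      ∃ (k : B) (u u' : AdeleRing (𝓞 F) F ⊗[F] B), k ∉ I.asIdeal ∧ τ k - k ∈ I.asIdeal ∧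
        Algebra.TensorProduct.map (AlgHom.id (AdeleRing (𝓞 F) F) (AdeleRing (𝓞 F) F)) (Ideal.Quotient.mkₐ F I.asIdeal) (u * u') = 1 ∧
        Algebra.TensorProduct.map (AlgHom.id (AdeleRing (𝓞 F) F) (AdeleRing (𝓞 F) F)) (Ideal.Quotient.mkₐ F I.asIdeal) X =
          Algebra.TensorProduct.map (AlgHom.id (AdeleRing (𝓞 F) F) (AdeleRing (𝓞 F) F)) (Ideal.Quotient.mkₐ F I.asIdeal)
            ((1 : AdeleRing (𝓞 F) F) ⊗ₜ k * u *
              Algebra.TensorProduct.map (AlgHom.id (AdeleRing (𝓞 F) F) (AdeleRing (𝓞 F) F)) (τ : B →ₐ[F] B) u)) :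
    ∃ y : Bˣ, τ (y : B) = y ∧ ∃ t : (AdeleRing (𝓞 F) F ⊗[F] B)ˣ,
      (X : AdeleRing (𝓞 F) F ⊗[F] B) = (1 : AdeleRing (𝓞 F) F) ⊗ₜ (y : B) * (t : AdeleRing (𝓞 F) F ⊗[F] B) *
        Algebra.TensorProduct.map (AlgHom.id (AdeleRing (𝓞 F) F) (AdeleRing (𝓞 F) F)) (τ : B →ₐ[F] B)
          (t : AdeleRing (𝓞 F) F ⊗[F] B) := by
  classical
  haveI : IsArtinianRing B := IsArtinianRing.of_finite F B
  -- notation-free abbreviations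
  set mapτ := Algebra.TensorProduct.map (AlgHom.id (AdeleRing (𝓞 F) F) (AdeleRing (𝓞 F) F)) (τ : B →ₐ[F] B) with hmapτ
  set πA : ∀ I : MaximalSpectrum B, AdeleRing (𝓞 F) F ⊗[F] B →ₐ[AdeleRing (𝓞 F) F] AdeleRing (𝓞 F) F ⊗[F] (B ⧸ I.asIdeal) :=
    fun I => Algebra.TensorProduct.map (AlgHom.id (AdeleRing (𝓞 F) F) (AdeleRing (𝓞 F) F)) (Ideal.Quotient.mkₐ F I.asIdeal) with hπA
  -- `τ` on the maximal ideals
  let J : MaximalSpectrum B → MaximalSpectrum B := fun I =>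
    ⟨I.asIdeal.comap (τ : B →ₐ[F] B), by haveI := I.isMaximal; exact Ideal.comap_isMaximal_of_equiv τ⟩
  have hmemJ : ∀ (I : MaximalSpectrum B) (x : B), x ∈ (J I).asIdeal ↔ τ x ∈ I.asIdeal := fun I x => Ideal.mem_comap
  have hJJ : ∀ I, J (J I) = I := by
    intro I
    apply MaximalSpectrum.ext
    ext x
    rw [hmemJ, hmemJ, hτ]
  obtain ⟨idx, hidx⟩ := Countable.exists_injective_nat (MaximalSpectrum B)
  choose! k u u' hk using hloc
  -- components
  let c : MaximalSpectrum B → B := fun I => if J I = I then k I else 1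
  let s : MaximalSpectrum B → AdeleRing (𝓞 F) F ⊗[F] B := fun I =>
    if J I = I then u I else if idx I < idx (J I) then (X : AdeleRing (𝓞 F) F ⊗[F] B) else 1
  let s' : MaximalSpectrum B → AdeleRing (𝓞 F) F ⊗[F] B := fun I =>
    if J I = I then u' I else if idx I < idx (J I) then ((X⁻¹ : (AdeleRing (𝓞 F) F ⊗[F] B)ˣ) : AdeleRing (𝓞 F) F ⊗[F] B) else 1
  have hlt_of : ∀ I, J I ≠ I → ¬ idx I < idx (J I) → idx (J I) < idx I := by
    intro I hI hlt
    rcases Nat.lt_or_ge (idx (J I)) (idx I) with h | h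
    · exact h
    · exfalso
      rcases Nat.eq_or_lt_of_le h with h | h
      · exact hI (hidx h.symm)
      · exact hlt h
  -- §y the rational factor
  have hc_not_mem : ∀ I : MaximalSpectrum B, c I ∉ I.asIdeal := by
    intro I
    by_cases hI : J I = I
    · simp only [c, hI, if_true]
      exact (hk I (congrArg MaximalSpectrum.asIdeal hI)).1
    · simp only [c, hI, if_false]
      exact fun hm => Ideal.IsPrime.ne_top' ((Ideal.eq_top_iff_one I.asIdeal).2 hm)
  have hcτ : ∀ I : MaximalSpectrum B, τ (c (J I)) - c I ∈ I.asIdeal := by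
    intro I
    by_cases hI : J I = I
    · rw [hI]
      simp only [c, hI, if_true]
      exact (hk I (congrArg MaximalSpectrum.asIdeal hI)).2.1
    · have hne : J (J I) ≠ J I := by rw [hJJ]; exact Ne.symm hI
      simp only [c, hI, hne, if_false, map_one, sub_self]
      exact zero_mem _
  set eB := IsArtinianRing.equivPi B with heB
  set y : B := eB.symm fun I => Ideal.Quotient.mk I.asIdeal (c I) with hydef
  have heBz : ∀ z : B, ∀ I : MaximalSpectrum B, eB z I = Ideal.Quotient.mk I.asIdeal z := fun z I => rfl
  have hy : ∀ I : MaximalSpectrum B, Ideal.Quotient.mk I.asIdeal y = Ideal.Quotient.mk I.asIdeal (c I) := by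
    intro I
    rw [← heBz, hydef, AlgEquiv.apply_symm_apply]
  have hτy : τ y = y := by
    apply eB.injective
    funext I
    rw [heBz, heBz, hy]
    have h1 : Ideal.Quotient.mk I.asIdeal (τ y) = Ideal.Quotient.mk I.asIdeal (τ (c (J I))) := by
      rw [Ideal.Quotient.eq, ← map_sub, ← hmemJ, ← Ideal.Quotient.eq]
      exact hy (J I)
    rw [h1, Ideal.Quotient.eq]
    exact hcτ I
  have hyunit : IsUnit y := by
    have heu : IsUnit (eB y) := by
      refine Pi.isUnit_iff.2 fun I => ?_
      rw [heBz, hy]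
      obtain ⟨z, i, hi, hz⟩ := I.isMaximal.exists_inv (hc_not_mem I)
      refine IsUnit.of_mul_eq_one (Ideal.Quotient.mk I.asIdeal z) ?_
      rw [← map_mul, ← (Ideal.Quotient.mk I.asIdeal).map_one, Ideal.Quotient.eq, ← hz]
      ring_nf
      simpa using I.asIdeal.neg_mem_iff.2 hi
    simpa [heB] using heu.map eB.symm
  -- §t the adelic factor, glued from its projections
  obtain ⟨z, hz, -⟩ := exists_unique_forall_map_mk_eq (F := F) (B := B) fun I => πA I (s I)
  obtain ⟨z', hz', -⟩ := exists_unique_forall_map_mk_eq (F := F) (B := B) fun I => πA I (s' I)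
  have hzz' : z * z' = 1 := by
    apply eq_of_forall_map_mk_eq (F := F) (B := B)
    intro I
    change πA I (z * z') = πA I 1
    rw [map_mul, map_one, hz I, hz' I, ← map_mul]
    by_cases hI : J I = I
    · simp only [s, s', hI, if_true]
      exact (hk I (congrArg MaximalSpectrum.asIdeal hI)).2.2.1
    · by_cases hlt : idx I < idx (J I)
      · simp only [s, s', hI, if_false, hlt, if_true, Units.mul_inv, map_one]
      · simp only [s, s', hI, if_false, hlt, mul_one, map_one]
  let t : (AdeleRing (𝓞 F) F ⊗[F] B)ˣ := ⟨z, z', hzz', (mul_comm z' z).trans hzz'⟩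
  -- §assembly
  refine ⟨hyunit.unit, by rw [IsUnit.unit_spec]; exact hτy, t, ?_⟩
  apply eq_of_forall_map_mk_eq (F := F) (B := B)
  intro I
  change πA I X = πA I ((1 : AdeleRing (𝓞 F) F) ⊗ₜ hyunit.unit.val * z * mapτ z)
  have hτz : πA I (mapτ z) = πA I (mapτ (s (J I))) :=
    map_mk_map_eq_of_map_mk_comap_eq τ I.asIdeal (hz (J I))
  have h1y : πA I ((1 : AdeleRing (𝓞 F) F) ⊗ₜ hyunit.unit.val) = πA I ((1 : AdeleRing (𝓞 F) F) ⊗ₜ c I) := by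
    rw [IsUnit.unit_spec, hπA]
    simp only [Algebra.TensorProduct.map_tmul, AlgHom.id_apply, Ideal.Quotient.mkₐ_eq_mk, hy]
  rw [map_mul, map_mul, hz I, hτz, h1y, ← map_mul, ← map_mul]
  by_cases hI : J I = I
  · rw [hI]
    simp only [c, s, hI, if_true]
    exact (hk I (congrArg MaximalSpectrum.asIdeal hI)).2.2.2
  · have hJI : J (J I) = I := hJJ I
    have hne : J (J I) ≠ J I := by rw [hJI]; exact Ne.symm hI
    by_cases hlt : idx I < idx (J I)
    · have hsJ : s (J I) = 1 := by
        have h' : ¬ idx (J I) < idx (J (J I)) := by rw [hJI]; omega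
        simp only [s, hne, if_false, h']
      simp only [c, s, hI, if_false, hlt, if_true, hsJ, map_one, mul_one]
      rw [← Algebra.TensorProduct.one_def, one_mul]
    · have hsJ : s (J I) = X := by
        have h' : idx (J I) < idx (J (J I)) := by rw [hJI]; exact hlt_of I hI hlt
        simp only [s, hne, if_false, h', if_true]
      simp only [c, s, hI, if_false, hlt, hsJ]
      rw [← Algebra.TensorProduct.one_def, one_mul, one_mul, hX]


/-- Lifting a unit of `𝔸_F ⊗_F B∕𝔪` to `𝔸_F ⊗_F B`: representatives `u, u′` with `(1 ⊗ π_𝔪)(u u′) = 1` (`1 ⊗ π_𝔪` is onto, `⊗` being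
right exact) — the shape in which `exists_fixed_unit_tmul_mul_mul_map_eq` takes its local data. [cite: CasselsFrohlichANT1967, Ch. II §14] -/
theorem exists_map_mk_eq_of_unit (I : Ideal B) (u₀ : (AdeleRing (𝓞 F) F ⊗[F] (B ⧸ I))ˣ) :
    ∃ u u' : AdeleRing (𝓞 F) F ⊗[F] B,
      Algebra.TensorProduct.map (AlgHom.id (AdeleRing (𝓞 F) F) (AdeleRing (𝓞 F) F)) (Ideal.Quotient.mkₐ F I) u = u₀ ∧
      Algebra.TensorProduct.map (AlgHom.id (AdeleRing (𝓞 F) F) (AdeleRing (𝓞 F) F)) (Ideal.Quotient.mkₐ F I) (u * u') = 1 := by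
  have hsurj : Function.Surjective
      (Algebra.TensorProduct.map (AlgHom.id (AdeleRing (𝓞 F) F) (AdeleRing (𝓞 F) F)) (Ideal.Quotient.mkₐ F I)) := fun w => by
    have hg : Function.Surjective ((Ideal.Quotient.mkₐ F I).toLinearMap) := Ideal.Quotient.mkₐ_surjective F I
    obtain ⟨v, hv⟩ := LinearMap.lTensor_surjective (AdeleRing (𝓞 F) F) hg w
    exact ⟨v, hv⟩
  obtain ⟨u, hu⟩ := hsurj (u₀ : AdeleRing (𝓞 F) F ⊗[F] (B ⧸ I))
  obtain ⟨u', hu'⟩ := hsurj ((u₀⁻¹ : (AdeleRing (𝓞 F) F ⊗[F] (B ⧸ I))ˣ) : AdeleRing (𝓞 F) F ⊗[F] (B ⧸ I))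
  exact ⟨u, u', hu, by rw [map_mul, hu, hu', Units.mul_inv]⟩

end Global

/-! ## §4 (D4) From the factor's adelic equation to the representative data of (D3) -/

section Lift

open scoped NumberField.AdeleRing
open Literature.NumberTheory.AdelicBaseChange Literature.NumberTheory.Automorphic

variable {F B C : Type} [Field F] [NumberField F] [CommRing B] [Algebra F B] [Field C] [NumberField C] [Algebra F C]
  (τ : B ≃ₐ[F] B) (π : B →ₐ[F] C) (τC : C ≃ₐ[F] C) (hτπ : ∀ b, π (τ b) = τC (π b))
include hτπ

/-- **(D4) from the factor to representatives.**  If, in `𝔸_C`, the image of `X ∈ 𝔸_F ⊗_F B` is «principal `τ_C`-fixed × idelic norm»,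
`e_C((1 ⊗ π) X) = (k_C)_{𝔸_C} · (U · τ_C • U)` with `k_C ≠ 0`, `τ_C k_C = k_C`, `U ∈ 𝔸_Cˣ` (the output of Galois descent + the vanishing of
the quadratic norm-residue indicator of `C ∕ C^{τ_C}`), then `X` has the representative data of `exists_fixed_unit_tmul_mul_mul_map_eq` at this
factor: `k ∈ B` with `π k ≠ 0`, `π (τ k) = π k`, and `u, u′ ∈ 𝔸_F ⊗_F B` with `(1 ⊗ π)(u u′) = 1`, `(1 ⊗ π) X = (1 ⊗ π)((1 ⊗ k) u (1 ⊗ τ)u)`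
(`π` onto; `⊗` right exact). [cite: CasselsFrohlichANT1967, Ch. II §14, §19 (19.1)] -/
theorem exists_repr_of_adeleRingTensorAlgEquiv_map_eq (hπ : Function.Surjective π) {X : AdeleRing (𝓞 F) F ⊗[F] B} {kC : C}
    (hkC0 : kC ≠ 0) (hkC : τC kC = kC) (U : (AdeleRing (𝓞 C) C)ˣ)
    (h : adeleRingTensorAlgEquiv F C (Algebra.TensorProduct.map (AlgHom.id (AdeleRing (𝓞 F) F) (AdeleRing (𝓞 F) F)) π X) =
      algebraMap C (AdeleRing (𝓞 C) C) kC * ((U : AdeleRing (𝓞 C) C) * τC • (U : AdeleRing (𝓞 C) C))) :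
    ∃ (k : B) (u u' : AdeleRing (𝓞 F) F ⊗[F] B), π k ≠ 0 ∧ π (τ k) = π k ∧
      Algebra.TensorProduct.map (AlgHom.id (AdeleRing (𝓞 F) F) (AdeleRing (𝓞 F) F)) π (u * u') = 1 ∧
      Algebra.TensorProduct.map (AlgHom.id (AdeleRing (𝓞 F) F) (AdeleRing (𝓞 F) F)) π X =
        Algebra.TensorProduct.map (AlgHom.id (AdeleRing (𝓞 F) F) (AdeleRing (𝓞 F) F)) π
          ((1 : AdeleRing (𝓞 F) F) ⊗ₜ k * u *
            Algebra.TensorProduct.map (AlgHom.id (AdeleRing (𝓞 F) F) (AdeleRing (𝓞 F) F)) (τ : B →ₐ[F] B) u) := by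
  have hsurj : Function.Surjective
      (Algebra.TensorProduct.map (AlgHom.id (AdeleRing (𝓞 F) F) (AdeleRing (𝓞 F) F)) π) := fun w => by
    have hg : Function.Surjective (π.toLinearMap) := hπ
    obtain ⟨v, hv⟩ := LinearMap.lTensor_surjective (AdeleRing (𝓞 F) F) hg w
    exact ⟨v, hv⟩
  obtain ⟨k, hk⟩ := hπ kC
  obtain ⟨u, hu⟩ := hsurj ((adeleRingTensorAlgEquiv F C).symm (U : AdeleRing (𝓞 C) C))
  obtain ⟨u', hu'⟩ := hsurj ((adeleRingTensorAlgEquiv F C).symm ((U⁻¹ : (AdeleRing (𝓞 C) C)ˣ) : AdeleRing (𝓞 C) C))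
  refine ⟨k, u, u', by rw [hk]; exact hkC0, by rw [hτπ, hk, hkC], ?_, ?_⟩
  · rw [map_mul, hu, hu', ← map_mul, Units.mul_inv, map_one]
  · apply (adeleRingTensorAlgEquiv F C).injective
    rw [h, map_mul, map_mul, map_mul, map_mul, Algebra.TensorProduct.map_tmul, AlgHom.id_apply, hk, adeleRingTensorAlgEquiv_one_tmul,
      ← smul_adeleRingTensorAlgEquiv_map τ π τC hτπ, hu, AlgEquiv.apply_symm_apply, mul_assoc]

end Lift

end Literature.NumberTheory.GaloisRepresentations
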